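import Literature.MathematicalPhysics.QuantumLattice.HubbardLinkedCluster
import HarnessLib

/-!
# The linked-cluster theorem for two-point functions of `dΓ(h) + g Σ_x n_{x↑}n_{x↓}` (any one-body `h`)

Topic `MathematicalPhysics/QuantumLattice`; programme under the tree's fact `bgm_two_point_limit`.
`HubbardDysonDeterminant.lean` / `HubbardLinkedCluster.lean` prove BGM's (2.6)/(2.8) and the
finite-volume linked-cluster theorem `⟨c†_{xσ}c_{yσ'}⟩ = Σ_j U^j t_j` for the grand-canonical Hubbard
Hamiltonian `H(t,U) - μN = dΓ(hubbardOneBody G t μ) + U Σ_x n_{x↑}n_{x↓}`. Their integrands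
(`truncatedIntegrand`, `vacuumIntegrand`, `twoPointIntegrand`) and the block identity
`orderedIntegral_twoPointIntegrand_eq_sum_antidiagonal` (`a = t ⋆ b`) are stated for an ARBITRARY
one-body matrix `h` on the orbitals; only the final assembly is specialised to `hubbardOneBody`.
This file records the assembly for a general Hermitian `h` and a real coupling `g`:

* `hasSum_twoPointIntegrand`, `hasSum_vacuumIntegrand` — the Dyson series of
  `Tr(e^{-β(dΓ(h)+gD)} c†_{xσ}c_{yσ'})` and `Tr e^{-β(dΓ(h)+gD)}`, `D = Σ_x c†_{x↑}c_{x↑}c†_{x↓}c_{x↓}`, with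
  determinant coefficients (`hasSum_dyson_trace_gibbsWeight_quartic` / `…_partitionFn_quartic` +
  the time-ordered Wick theorem `gibbsState_dGamma_twoPoint_mul_prod_hubbardVertex_eq_det`);
* `summable_norm_vacuumIntegrand` — absolute convergence of the vacuum series (every `g`);
* **`thermalCorr_dGamma_add_onSite_eq_tsum_truncated`** — whenever `Σ_j ‖g^j t_j(h)‖ < ∞`,
  `⟨c†_{xσ}c_{yσ'}⟩_{β, dΓ(h)+gD} = Σ_j g^j t_j(h)`,
  `t_j(h) = orderedIntegral j (truncatedIntegrand β h (x,σ) (y,σ') j) 1 = (-β)^j ∫_{Δ_j} Σ_{x⃗} 𝓔ᵀ(c†_{xσ}c_{yσ'}; n_{x₁↑}n_{x₁↓}(s₁); …)`.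

Use: one-body matrices other than `-t[x∼y] - μ` — the Shiba-transformed `d`-wave–sourced torus
(`DWaveSourceDysonSeries.shibaOneBody`, whose pair source is a spin-flip hopping and whose coupling is
`-U`), twisted / magnetic Hubbard tori (Peierls phases in `h`), Hartree-shifted propagators.
Everything is PROVED; no definition and no named fact (the coefficients are written with the tree's
`truncatedIntegrand` / `vacuumIntegrand` / `twoPointIntegrand`).

## References

* G. Benfatto, A. Giuliani, V. Mastropietro, Ann. Henri Poincaré 7 (2006) 809–898, §2.1 (2.6)–(2.8),
  §2.2 (2.13)–(2.16). [BenfattoGiulianiMastropietro2006]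
* V. Mastropietro, *Non-Perturbative Renormalization* (2008), §2.3–2.4 (2.32)–(2.40). [Mastropietro2008]
-/

noncomputable section

open scoped Matrix.Norms.L2Operator ComplexOrder
open Finset MeasureTheory intervalIntegral Filter Topology NormedSpace Matrix

namespace Literature.MathematicalPhysics.QuantumLattice

section General

variable {Λ : Type*} [LinearOrder Λ] [Fintype Λ]

/-- The on-site quartic word `Σ_x c†_{x↑}c_{x↑}c†_{x↓}c_{x↓} = Σ_x n_{x↑}n_{x↓}` is Hermitian (commuting
Hermitian number operators). [folklore] -/
theorem isHermitian_sum_onSiteWord :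
    (∑ x : Λ, creation (orb x 0) * annihilation (orb x 0) * (creation (orb x 1) * annihilation (orb x 1)) :
      Matrix (Finset (Orb Λ)) (Finset (Orb Λ)) ℂ).IsHermitian := by
  rw [IsHermitian, conjTranspose_sum]
  refine Finset.sum_congr rfl fun x _ => ?_
  change (numberAt (orb x 0) * numberAt (orb x 1))ᴴ = numberAt (orb x 0) * numberAt (orb x 1)
  rw [conjTranspose_mul, (numberAt_isHermitian _).eq, (numberAt_isHermitian _).eq]
  exact (numberAt_commute _ _).eq

/-- `dΓ(h) + g Σ_x n_{x↑}n_{x↓}` is Hermitian for Hermitian `h` and real `g`. [folklore] -/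
theorem isHermitian_dGamma_add_onSite {h : Matrix (Orb Λ) (Orb Λ) ℂ} (hh : h.IsHermitian) (g : ℝ) :
    (dGamma h + (g : ℂ) • ∑ x : Λ, creation (orb x 0) * annihilation (orb x 0) *
      (creation (orb x 1) * annihilation (orb x 1))).IsHermitian := by
  refine (isHermitian_dGamma hh).add (IsHermitian.smul isHermitian_sum_onSiteWord ?_)
  rw [isSelfAdjoint_iff, Complex.star_def, Complex.conj_ofReal]

/-- **Dyson series of the two-point function of `dΓ(h) + gD`, determinant coefficients** (BGM (2.8)
for an arbitrary Hermitian one-body matrix `h`): for real `β, g`,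
`Tr(e^{-β(dΓ(h)+gD)} c†_{xσ}c_{yσ'}) = Σ_k g^k ∫_{Δ_k} twoPointIntegrand β h (x,σ) (y,σ') Z₀(h) k`,
`Z₀(h) = Tr e^{-βdΓ(h)}`. [cite: BenfattoGiulianiMastropietro2006, §2.1 (2.8)] -/
theorem hasSum_twoPointIntegrand {h : Matrix (Orb Λ) (Orb Λ) ℂ} (hh : h.IsHermitian) (β g : ℝ)
    (x y : Λ) (σ σ' : Fin 2) :
    HasSum (fun k : ℕ => (g : ℂ) ^ k *
        orderedIntegral k (twoPointIntegrand β h (orb x σ) (orb y σ') (Matrix.partitionFn β (dGamma h)) k) 1)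
      ((Matrix.gibbsWeight β (dGamma h + (g : ℂ) • ∑ z : Λ, creation (orb z 0) * annihilation (orb z 0) *
          (creation (orb z 1) * annihilation (orb z 1))) *
        (creation (orb x σ) * annihilation (orb y σ'))).trace) := by
  haveI : Nonempty (Finset (Orb Λ)) := ⟨∅⟩
  have hZ : Matrix.partitionFn β (dGamma h) ≠ 0 := (Matrix.partitionFn_pos β (isHermitian_dGamma hh)).ne'
  have hs := hasSum_dyson_trace_gibbsWeight_quartic β h (fun _ : Λ => (1 : ℂ))
    (fun z => orb z 0) (fun z => orb z 0) (fun z => orb z 1) (fun z => orb z 1) (orb x σ) (orb y σ') (g : ℂ)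
  simp only [Finset.prod_const_one, one_mul, one_smul] at hs
  refine hs.congr_fun fun k => ?_
  unfold twoPointIntegrand twoPointPropMatrix propMatrix
  refine congrArg (fun F => (g : ℂ) ^ k * orderedIntegral k F 1) (funext fun u => ?_)
  refine congrArg (fun S => (-(β : ℂ)) ^ k * S) (Finset.sum_congr rfl fun f _ => ?_)
  rw [← gibbsState_dGamma_twoPoint_mul_prod_hubbardVertex_eq_det hh β x y σ σ' f
    (fun i : Fin k => ((u i : ℝ) : ℂ) * -(β : ℂ)), Matrix.gibbsState_apply, mul_inv_cancel_left₀ hZ]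

/-- **Dyson series of the partition function of `dΓ(h) + gD`, determinant coefficients** (BGM (2.6)
for an arbitrary Hermitian `h`): `Tr e^{-β(dΓ(h)+gD)} = Σ_m g^m ∫_{Δ_m} vacuumIntegrand β h Z₀(h) m`.
[cite: BenfattoGiulianiMastropietro2006, §2.1 (2.6)] -/
theorem hasSum_vacuumIntegrand {h : Matrix (Orb Λ) (Orb Λ) ℂ} (hh : h.IsHermitian) (β g : ℝ) :
    HasSum (fun m : ℕ => (g : ℂ) ^ m *
        orderedIntegral m (vacuumIntegrand β h (Matrix.partitionFn β (dGamma h)) m) 1)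
      (Matrix.partitionFn β (dGamma h + (g : ℂ) • ∑ z : Λ, creation (orb z 0) * annihilation (orb z 0) *
          (creation (orb z 1) * annihilation (orb z 1)))) := by
  haveI : Nonempty (Finset (Orb Λ)) := ⟨∅⟩
  have hZ : Matrix.partitionFn β (dGamma h) ≠ 0 := (Matrix.partitionFn_pos β (isHermitian_dGamma hh)).ne'
  have hs := hasSum_dyson_partitionFn_quartic β h (fun _ : Λ => (1 : ℂ))
    (fun z => orb z 0) (fun z => orb z 0) (fun z => orb z 1) (fun z => orb z 1) (g : ℂ)
  simp only [Finset.prod_const_one, one_mul, one_smul] at hs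
  refine hs.congr_fun fun m => ?_
  unfold vacuumIntegrand vacuumPropMatrix propMatrix
  refine congrArg (fun F => (g : ℂ) ^ m * orderedIntegral m F 1) (funext fun u => ?_)
  refine congrArg (fun S => (-(β : ℂ)) ^ m * S) (Finset.sum_congr rfl fun f _ => ?_)
  rw [← gibbsState_dGamma_prod_hubbardVertex_eq_det hh β f (fun i : Fin m => ((u i : ℝ) : ℂ) * -(β : ℂ)),
    Matrix.gibbsState_apply, mul_inv_cancel_left₀ hZ]

/-- **The vacuum series converges absolutely** for every `g` (it is the Dyson series of a matrix
exponential). [folklore] -/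
theorem summable_norm_vacuumIntegrand {h : Matrix (Orb Λ) (Orb Λ) ℂ} (hh : h.IsHermitian) (β g : ℝ) :
    Summable fun m : ℕ => ‖(g : ℂ) ^ m *
      orderedIntegral m (vacuumIntegrand β h (Matrix.partitionFn β (dGamma h)) m) 1‖ := by
  haveI : Nonempty (Finset (Orb Λ)) := ⟨∅⟩
  have hZ : Matrix.partitionFn β (dGamma h) ≠ 0 := (Matrix.partitionFn_pos β (isHermitian_dGamma hh)).ne'
  have hs := summable_norm_dyson_trace_gibbsWeight_sum β (dGamma h) 1 (fun _ : Λ => (1 : ℂ))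
    (fun r => creation (orb r 0) * annihilation (orb r 0) * (creation (orb r 1) * annihilation (orb r 1)))
    (g : ℂ)
  simp only [exp_mul_mul_mul_exp_neg, Finset.prod_const_one, one_mul] at hs
  refine hs.congr fun m => ?_
  unfold vacuumIntegrand vacuumPropMatrix propMatrix
  refine congrArg (fun F => ‖(g : ℂ) ^ m * orderedIntegral m F 1‖) (funext fun u => ?_)
  refine congrArg (fun S => (-(β : ℂ)) ^ m * S) (Finset.sum_congr rfl fun f _ => ?_)
  rw [← gibbsState_dGamma_prod_hubbardVertex_eq_det hh β f (fun i : Fin m => ((u i : ℝ) : ℂ) * -(β : ℂ)),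
    Matrix.gibbsState_apply, mul_inv_cancel_left₀ hZ]

/-- **Linked-cluster theorem, numerator form** (`a = t ⋆ b` summed): whenever the truncated series
converges absolutely at the real coupling `g`,
`(Σ_j g^j t_j(h)) · Tr e^{-β(dΓ(h)+gD)} = Tr(e^{-β(dΓ(h)+gD)} c†_{xσ}c_{yσ'})`.
[cite: BenfattoGiulianiMastropietro2006, §2.2 (2.14)-(2.16)] -/
theorem tsum_truncatedIntegrand_mul_partitionFn {h : Matrix (Orb Λ) (Orb Λ) ℂ} (hh : h.IsHermitian)
    (β g : ℝ) (x y : Λ) (σ σ' : Fin 2)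
    (hT : Summable fun j : ℕ => ‖(g : ℂ) ^ j *
      orderedIntegral j (truncatedIntegrand β h (orb x σ) (orb y σ') j) 1‖) :
    (∑' j : ℕ, (g : ℂ) ^ j * orderedIntegral j (truncatedIntegrand β h (orb x σ) (orb y σ') j) 1) *
        Matrix.partitionFn β (dGamma h + (g : ℂ) • ∑ z : Λ, creation (orb z 0) * annihilation (orb z 0) *
          (creation (orb z 1) * annihilation (orb z 1))) =
      (Matrix.gibbsWeight β (dGamma h + (g : ℂ) • ∑ z : Λ, creation (orb z 0) * annihilation (orb z 0) *
          (creation (orb z 1) * annihilation (orb z 1))) *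
        (creation (orb x σ) * annihilation (orb y σ'))).trace := by
  rw [← (hasSum_vacuumIntegrand hh β g).tsum_eq,
    tsum_mul_tsum_eq_tsum_sum_antidiagonal_of_summable_norm hT (summable_norm_vacuumIntegrand hh β g),
    ← (hasSum_twoPointIntegrand hh β g x y σ σ').tsum_eq]
  refine tsum_congr fun k => ?_
  rw [orderedIntegral_twoPointIntegrand_eq_sum_antidiagonal, Finset.mul_sum]
  refine Finset.sum_congr rfl fun p hp => ?_
  rw [← HasAntidiagonal.mem_antidiagonal.1 hp, pow_add]
  ring

/-- **The linked-cluster theorem for the two-point function of `dΓ(h) + g Σ_x n_{x↑}n_{x↓}` (finite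
volume, any Hermitian one-body matrix `h`, real `g`)**: whenever the truncated series converges
absolutely at `g`,
`⟨c†_{xσ}c_{yσ'}⟩_{β, dΓ(h)+gD} = Σ_j g^j t_j(h)`,
`t_j(h) = (-β)^j ∫_{Δ_j} Σ_{x⃗} 𝓔ᵀ(c†_{xσ}c_{yσ'}; n_{x₁↑}n_{x₁↓}(s₁); …; n_{x_j↑}n_{x_j↓}(s_j))` the truncated
(connected) coefficients of the free propagator of `h` (`truncatedIntegrand`). The Hubbard case
`h = hubbardOneBody G t μ` is `thermalCorr_hubbard_eq_tsum_truncated`. BGM 2006 (2.8), (2.13)–(2.16);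
Mastropietro 2008 (2.38)–(2.40). [cite: BenfattoGiulianiMastropietro2006, §2.2 (2.14)-(2.16)] -/
theorem thermalCorr_dGamma_add_onSite_eq_tsum_truncated {h : Matrix (Orb Λ) (Orb Λ) ℂ}
    (hh : h.IsHermitian) (β g : ℝ) (x y : Λ) (σ σ' : Fin 2)
    (hT : Summable fun j : ℕ => ‖(g : ℂ) ^ j *
      orderedIntegral j (truncatedIntegrand β h (orb x σ) (orb y σ') j) 1‖) :
    Matrix.thermalCorr β (dGamma h + (g : ℂ) • ∑ z : Λ, creation (orb z 0) * annihilation (orb z 0) *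
          (creation (orb z 1) * annihilation (orb z 1)))
        (creation (orb x σ)) (annihilation (orb y σ')) =
      ∑' j : ℕ, (g : ℂ) ^ j * orderedIntegral j (truncatedIntegrand β h (orb x σ) (orb y σ') j) 1 := by
  haveI : Nonempty (Finset (Orb Λ)) := ⟨∅⟩
  have hZ : Matrix.partitionFn β (dGamma h + (g : ℂ) • ∑ z : Λ, creation (orb z 0) * annihilation (orb z 0) *
      (creation (orb z 1) * annihilation (orb z 1))) ≠ 0 :=
    (Matrix.partitionFn_pos β (isHermitian_dGamma_add_onSite hh g)).ne'
  rw [Matrix.thermalCorr, Matrix.gibbsState_apply,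
    ← tsum_truncatedIntegrand_mul_partitionFn hh β g x y σ σ' hT, mul_comm _ (Matrix.partitionFn _ _),
    inv_mul_cancel_left₀ hZ]

/-- Consistency with the Hubbard specialisation: the tree's `hubbardTruncatedCoeff` is the present
coefficient at `h = hubbardOneBody G t μ`. [folklore] -/
theorem hubbardTruncatedCoeff_eq_orderedIntegral_truncatedIntegrand (G : SimpleGraph Λ) [DecidableRel G.Adj]
    (β t μ : ℝ) (x y : Λ) (σ σ' : Fin 2) (j : ℕ) :
    hubbardTruncatedCoeff G β t μ x y σ σ' j =
      orderedIntegral j (truncatedIntegrand β (hubbardOneBody G t μ) (orb x σ) (orb y σ') j) 1 := rfl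

end General

end Literature.MathematicalPhysics.QuantumLattice

end
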